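import Summits.CriticalPhenomena.Ising3DConformalLimit.Theorems.PerfectScreeningSubharmonicOffOriginAxisBalance
import Literature.Probability.LatticeModels.SharpnessProofs
import Literature.Probability.LatticeModels.CriticalTwoPointLower
import Literature.Probability.LatticeModels.MessagerMiracleSole
import Summits.CriticalPhenomena.Ising3DConformalLimit.Theorems.MoebiusLimitExists.Negative.AxisRatioRegularity
import HarnessLib

/-!
# Exact balance of the critical 3-D Ising two-point function along lines parallel to an axis
# (crux `SubharmonicOffOrigin`, stmt-CriticalPhenomena-1341, route PerfectScreening; by-product of
# lead c1, STRATEGY-CENSUS.md §S1 "new small fact" — helper `--supports`, not a proof of the crux)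

Let `G = criticalTwoPoint 3 = ⟨σ₀σ_x⟩⁺_{β_c(3)}` and `M(n) = G(n e₀) > 0`. For a fixed transverse
offset `(b, c) ∈ ℤ²` put `x_n = (n, b, c)`. We prove, unconditionally,
`∑ᵢ (G(x_n + eᵢ) + G(x_n − eᵢ)) / G(x_n) → 6` (`tendsto_nbrSum_div_shiftedAxis`), generalising the
axis case `b = c = 0` (`tendsto_nbrSum_div_axis`).

The proof is a squeeze. By the Messager–Miracle-Solé 1977 inequalities (axis form
`messager_miracleSole_holds`, diagonal form `messager_miracleSole_diag_holds`) and reflection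
symmetry, every site `y` with `|y₁|, |y₂| ≤ |y₀|` satisfies the sandwich
`M(|y₀| + |y₁| + |y₂|) ≤ G(y) ≤ M(|y₀|)` (`sandwich_natAbs`). The seven sites `x_n`, `x_n ± eᵢ` have
first coordinate `n` or `n ± 1` and bounded transverse coordinates, so each of the seven values
`G(·)` lies between `M(n + K)` and `M(n − 1)` for a fixed `K`; and `M(n + K)/M(n) → 1`,
`M(n − 1)/M(n) → 1` by the axis ratio regularity `M(n+1)/M(n) → 1`
(`criticalTwoPoint_axis_ratio_tendsto_one'`, Aizenman–Duminil-Copin 2021 + Simon–Lieb). Hence all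
seven ratios `G(·)/M(n)` tend to `1` and the quotient tends to `6/1`.

References: A. Messager, S. Miracle-Solé, J. Stat. Phys. 17 (1977) 245; G. C. Hegerfeldt, CMP 57
(1977) 259; M. Aizenman, H. Duminil-Copin, Ann. of Math. 194 (2021); B. Simon, CMP 77 (1980).
-/

noncomputable section

open Filter Topology Finset
open Literature.Probability.LatticeModels

namespace Summit.CriticalPhenomena.Ising3DConformalLimit.Theorems.PerfectScreening.AxisBalance

/-! ### Axis ratio regularity, shifted -/

/-- Axis ratio regularity, one step back: `M(n − 1)/M(n) → 1` for `M(n) = G(n e₀)` (inverse of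
`criticalTwoPoint_axis_ratio_tendsto_one'`). [folklore] -/
theorem axis_ratio_pred_tendsto_one :
    Tendsto (fun n : ℕ => criticalTwoPoint 3 (Pi.single 0 ((n - 1 : ℕ) : ℤ)) /
      criticalTwoPoint 3 (Pi.single 0 (n : ℤ))) atTop (𝓝 1) := by
  have hr := criticalTwoPoint_axis_ratio_tendsto_one' (0 : Fin 3)
  have hrinv : Tendsto (fun k : ℕ => criticalTwoPoint 3 (Pi.single 0 (k : ℤ)) /
      criticalTwoPoint 3 (Pi.single 0 ((k + 1 : ℕ) : ℤ))) atTop (𝓝 1) := by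
    have h := hr.inv₀ one_ne_zero
    rw [inv_one] at h
    refine h.congr fun k => ?_
    rw [inv_div]
  rw [← tendsto_add_atTop_iff_nat 1]
  refine hrinv.congr fun k => ?_
  rw [Nat.add_sub_cancel]

/-- **Squeeze along the axis scale.** If eventually `M(n + K) ≤ f(n) ≤ M(n − 1)` for a fixed `K`,
then `f(n)/M(n) → 1` (`M(n) = G(n e₀) > 0`, both bounds have ratio `→ 1`). [folklore] -/
theorem squeeze_ratio (f : ℕ → ℝ) (K : ℕ)
    (h : ∀ᶠ n : ℕ in atTop, criticalTwoPoint 3 (Pi.single 0 ((n + K : ℕ) : ℤ)) ≤ f n ∧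
      f n ≤ criticalTwoPoint 3 (Pi.single 0 ((n - 1 : ℕ) : ℤ))) :
    Tendsto (fun n : ℕ => f n / criticalTwoPoint 3 (Pi.single 0 (n : ℤ))) atTop (𝓝 1) := by
  refine tendsto_of_tendsto_of_tendsto_of_le_of_le' (Summit.CriticalPhenomena.Ising3DConformalLimit.AxisRatioRegularity.criticalTwoPoint_axis_ratio_shift_tendsto_one K)
    axis_ratio_pred_tendsto_one ?_ ?_
  · filter_upwards [h] with n hn
    exact div_le_div_of_nonneg_right hn.1 (criticalTwoPoint_axis_pos n).le
  · filter_upwards [h] with n hn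
    exact div_le_div_of_nonneg_right hn.2 (criticalTwoPoint_axis_pos n).le

/-! ### The Messager–Miracle-Solé sandwich -/

/-- **Messager–Miracle-Solé 1977 sandwich.** For a site `y ∈ ℤ³` whose first coordinate dominates,
`|y₁| ≤ |y₀|` and `|y₂| ≤ |y₀|`: `M(|y₀| + |y₁| + |y₂|) ≤ G(y) ≤ M(|y₀|)`. Reflect `y` into the
positive orthant (`twoPointPlus_abs_eq`, reflection symmetry); the upper bound zeroes the transverse
coordinates (`twoPointPlus_le_single_of_nonneg`, axis form of Messager–Miracle-Solé), the lower
bound collapses the mass onto the first axis by diagonal moves (`twoPointPlus_single_sum_le`,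
diagonal form). [folklore] -/
theorem sandwich_natAbs (y : Site 3) (h1 : (y 1).natAbs ≤ (y 0).natAbs)
    (h2 : (y 2).natAbs ≤ (y 0).natAbs) :
    criticalTwoPoint 3 (Pi.single 0 (((y 0).natAbs + (y 1).natAbs + (y 2).natAbs : ℕ) : ℤ)) ≤
        criticalTwoPoint 3 y ∧
      criticalTwoPoint 3 y ≤ criticalTwoPoint 3 (Pi.single 0 ((y 0).natAbs : ℤ)) := by
  set z : Site 3 := fun i => |y i| with hz
  have hz0 : ∀ i, 0 ≤ z i := fun i => abs_nonneg _
  have hzi : ∀ i, z i = (y i).natAbs := fun i => Int.abs_eq_natAbs (y i)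
  have habs : criticalTwoPoint 3 z = criticalTwoPoint 3 y :=
    twoPointPlus_abs_eq (d := 3) twoPointPlus_reflection_invariant_holds (criticalBeta_nonneg 3) y
  rw [← habs]
  refine ⟨?_, ?_⟩
  · have hcond : ∀ j : Fin 3, j ≠ 0 → 0 ≤ z j ∧ z j ≤ z 0 := by
      intro j hj
      refine ⟨hz0 j, ?_⟩
      rw [hzi, hzi]
      obtain rfl | rfl : j = 1 ∨ j = 2 := by omega
      · exact_mod_cast h1
      · exact_mod_cast h2
    have hsum : ∑ i, z i = (((y 0).natAbs + (y 1).natAbs + (y 2).natAbs : ℕ) : ℤ) := by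
      simp only [Fin.sum_univ_three, hzi, Nat.cast_add]
    have h := twoPointPlus_single_sum_le (d := 3) (β := criticalBeta 3)
      messager_miracleSole_diag_holds (criticalBeta_nonneg 3) 0
      (∑ j ∈ univ.erase 0, z j).toNat z hcond
      (by rw [Int.toNat_of_nonneg (Finset.sum_nonneg fun j _ => hz0 j)])
    rw [hsum] at h
    exact h
  · have h := twoPointPlus_le_single_of_nonneg (d := 3) (β := criticalBeta 3)
      messager_miracleSole_holds (criticalBeta_nonneg 3) z hz0 0
    rw [hzi 0] at h
    exact h

/-- The sandwich in the form used below: if `y₀ = m ∈ ℕ` and `|y₁|, |y₂| ≤ B ≤ m`, then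
`M(m + 2B) ≤ G(y) ≤ M(m)` (Messager–Miracle-Solé 1977 sandwich `sandwich_natAbs` and antitonicity of
`M`, `criticalTwoPoint_axis_antitone`). [folklore] -/
theorem sandwich_of_first_coord {m B : ℕ} (hB : B ≤ m) {y : Site 3} (h0 : y 0 = m)
    (h1 : (y 1).natAbs ≤ B) (h2 : (y 2).natAbs ≤ B) :
    criticalTwoPoint 3 (Pi.single 0 ((m + 2 * B : ℕ) : ℤ)) ≤ criticalTwoPoint 3 y ∧
      criticalTwoPoint 3 y ≤ criticalTwoPoint 3 (Pi.single 0 (m : ℤ)) := by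
  have hy0 : (y 0).natAbs = m := by rw [h0, Int.natAbs_natCast]
  obtain ⟨hlo, hhi⟩ := sandwich_natAbs y (by omega) (by omega)
  rw [hy0] at hlo hhi
  exact ⟨(criticalTwoPoint_axis_antitone
    (show m + (y 1).natAbs + (y 2).natAbs ≤ m + 2 * B by omega)).trans hlo, hhi⟩

/-! ### The seven ratios along a shifted axis -/

/-- Coordinates of a unit vector have modulus `≤ 1`. [folklore] -/
theorem natAbs_single_apply_le (i j : Fin 3) : ((Pi.single i (1 : ℤ) : Site 3) j).natAbs ≤ 1 := by
  rcases eq_or_ne j i with rfl | h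
  · simp
  · simp [h]

/-- **Ratio `→ 1` along a shifted axis.** For fixed `b, c ∈ ℤ` and a fixed offset `v ∈ ℤ³` with
`|v₀| ≤ 1`: `G((n, b, c) + v)/G(n e₀) → 1`. For `n` large the site `(n, b, c) + v` has first
coordinate `m ∈ {n − 1, n, n + 1}` dominating the transverse ones, so the Messager–Miracle-Solé 1977
sandwich gives `M(n + 2B + 1) ≤ M(m + 2B) ≤ G ≤ M(m) ≤ M(n − 1)` with `B = |b + v₁| + |c + v₂|`;
conclude by `squeeze_ratio`. [folklore] -/
theorem tendsto_div_axis_shifted (b c : ℤ) (v : Site 3) (hv : (v 0).natAbs ≤ 1) :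
    Tendsto (fun n : ℕ => criticalTwoPoint 3 ((![(n : ℤ), b, c] : Site 3) + v) /
      criticalTwoPoint 3 (Pi.single 0 (n : ℤ))) atTop (𝓝 1) := by
  obtain ⟨B, hB⟩ : ∃ B : ℕ, B = (b + v 1).natAbs + (c + v 2).natAbs := ⟨_, rfl⟩
  refine squeeze_ratio _ (2 * B + 1) ?_
  filter_upwards [eventually_ge_atTop (B + 2)] with n hn
  obtain ⟨m, hm⟩ : ∃ m : ℕ, (n : ℤ) + v 0 = m :=
    ⟨((n : ℤ) + v 0).toNat, (Int.toNat_of_nonneg (by omega)).symm⟩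
  obtain ⟨hlo, hhi⟩ := sandwich_of_first_coord (m := m) (B := B) (by omega)
    (y := (![(n : ℤ), b, c] : Site 3) + v) (by simpa using hm) (by simp [hB]) (by simp [hB])
  exact ⟨(criticalTwoPoint_axis_antitone (show m + 2 * B ≤ n + (2 * B + 1) by omega)).trans hlo,
    hhi.trans (criticalTwoPoint_axis_antitone (show n - 1 ≤ m by omega))⟩

/-! ### Exact balance along a shifted axis -/

/-- **Unconditional exact balance of the critical 3-D Ising two-point function along every line
parallel to a coordinate axis**: for fixed `b, c ∈ ℤ` and `x_n = (n, b, c)`,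
`∑ᵢ (G(x_n + eᵢ) + G(x_n − eᵢ)) / G(x_n) → 6` as `n → ∞`, i.e. `ΔG/G → 0` along the line, for
`G = ⟨σ₀σ_x⟩⁺_{β_c(3)}`. All seven values `G(x_n)`, `G(x_n ± eᵢ)` are `∼ G(n e₀)` by the
Messager–Miracle-Solé 1977 sandwich and the axis ratio regularity (`tendsto_div_axis_shifted`), so
the quotient tends to `6/1`. This generalises the axis case `tendsto_nbrSum_div_axis`
(`b = c = 0`). [folklore] -/
theorem tendsto_nbrSum_div_shiftedAxis : ∀ b c : ℤ, Tendsto (fun n : ℕ => (∑ i : Fin 3, (criticalTwoPoint 3 ((![(n : ℤ), b, c] : Site 3) + Pi.single i 1) + criticalTwoPoint 3 ((![(n : ℤ), b, c] : Site 3) - Pi.single i 1))) / criticalTwoPoint 3 (![(n : ℤ), b, c] : Site 3)) atTop (𝓝 6) := by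
  intro b c
  have hplus : ∀ i : Fin 3, Tendsto (fun n : ℕ =>
      criticalTwoPoint 3 ((![(n : ℤ), b, c] : Site 3) + Pi.single i 1) /
        criticalTwoPoint 3 (Pi.single 0 (n : ℤ))) atTop (𝓝 1) := fun i =>
    tendsto_div_axis_shifted b c (Pi.single i 1) (natAbs_single_apply_le i 0)
  have hminus : ∀ i : Fin 3, Tendsto (fun n : ℕ =>
      criticalTwoPoint 3 ((![(n : ℤ), b, c] : Site 3) - Pi.single i 1) /
        criticalTwoPoint 3 (Pi.single 0 (n : ℤ))) atTop (𝓝 1) := fun i => by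
    have h := tendsto_div_axis_shifted b c (-Pi.single i 1)
      (by rw [Pi.neg_apply, Int.natAbs_neg]; exact natAbs_single_apply_le i 0)
    simp only [← sub_eq_add_neg] at h
    exact h
  have hcenter : Tendsto (fun n : ℕ => criticalTwoPoint 3 (![(n : ℤ), b, c] : Site 3) /
      criticalTwoPoint 3 (Pi.single 0 (n : ℤ))) atTop (𝓝 1) := by
    have h := tendsto_div_axis_shifted b c 0 (by simp)
    simp only [add_zero] at h
    exact h
  have hsum : Tendsto (fun n : ℕ => ∑ i : Fin 3,
      (criticalTwoPoint 3 ((![(n : ℤ), b, c] : Site 3) + Pi.single i 1) /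
          criticalTwoPoint 3 (Pi.single 0 (n : ℤ)) +
        criticalTwoPoint 3 ((![(n : ℤ), b, c] : Site 3) - Pi.single i 1) /
          criticalTwoPoint 3 (Pi.single 0 (n : ℤ)))) atTop (𝓝 (∑ _i : Fin 3, ((1 : ℝ) + 1))) :=
    tendsto_finsetSum _ fun i _ => (hplus i).add (hminus i)
  have h6 : (∑ _i : Fin 3, ((1 : ℝ) + 1)) = 6 := by
    rw [Fin.sum_univ_three]
    norm_num
  rw [h6] at hsum
  have hnum : Tendsto (fun n : ℕ => (∑ i : Fin 3,
      (criticalTwoPoint 3 ((![(n : ℤ), b, c] : Site 3) + Pi.single i 1) +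
        criticalTwoPoint 3 ((![(n : ℤ), b, c] : Site 3) - Pi.single i 1))) /
      criticalTwoPoint 3 (Pi.single 0 (n : ℤ))) atTop (𝓝 6) := by
    refine hsum.congr fun n => ?_
    rw [Finset.sum_div]
    refine Finset.sum_congr rfl fun i _ => ?_
    rw [add_div]
  have h := hnum.mul (hcenter.inv₀ one_ne_zero)
  rw [inv_one, mul_one] at h
  refine h.congr fun n => ?_
  rw [inv_div, div_mul_div_cancel₀ (criticalTwoPoint_axis_pos n).ne']

end Summit.CriticalPhenomena.Ising3DConformalLimit.Theorems.PerfectScreening.AxisBalance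

end
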